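import Literature.Analysis.FluidPDE.OnsagerBDSVPerturbation
import Literature.Analysis.FluidPDE.OnsagerBDSVEnergy
import Literature.Analysis.FluidPDE.OnsagerBDSVEnergyPrincipal
import Literature.Analysis.FluidPDE.OnsagerBDSVEnergyPrincipalTools
import Literature.Analysis.FluidPDE.OnsagerBDSVEnergyPrincipalProofs
import Literature.Analysis.FluidPDE.OnsagerBDSVEnergyEstimateHolds
import Literature.Analysis.FluidPDE.DeRosaPertIncrement
import Literature.Analysis.FluidPDE.DeRosaPerturbation
import HarnessLib

/-!
# De Rosa's perturbation stage: the energy estimate Prop. 5.12 under the core hypotheses —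
# port of the BDSV proof of Prop. 6.2 (principal term), and part 5 of the assembly

L. De Rosa, *Infinitely many Leray–Hopf solutions for the fractional Navier–Stokes equations*,
Comm. PDE 44 (2019) 335–365 = arXiv:1801.10235, §5.5 Prop. 5.12: "The energy of `v_{q+1}`
satisfies `|e(t) - ∫|v_{q+1}|² - δ_{q+2}/2| ≲ δ_q^{1/2}δ_{q+1}^{1/2}λ_q^{1+2α}/λ_{q+1}`", whose proof
"is a consequence of Proposition 5.11 and Lemma 5.9 and does not involve the different structure
of the Navier–Stokes equations with respect to the Euler ones, thus … we refer to [BDLSV2017]" =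
Buckmaster–De Lellis–Székelyhidi–Vicol, CPAM 72 (2019), Prop. 6.2 and §6.2 (`∑ᵢ∫tr R_{q,i} = 3ρ_q`,
the curl form (5.28), the stationary-phase estimate (C.1)). Exactly as the source says, the tree's
BDSV proof uses of the input only the core hypotheses (`tr R̊̄_q = 0` enters here); this file
re-runs it VERBATIM under `DeRosa.CoreHypotheses` (namespace `DeRosa`, same names as the BDSV
twins), continuing `DeRosaPertDeformation/Transport/Corrector/Increment.lean`:

* `DeRosa.energy_principalTerm`, `DeRosa.energy_oscillatoryTerm` (the principal/oscillatory terms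
  of §6.2 with `CoreHypotheses`) PROVED: `energy_oscillatoryTerm_holds` (through
  `BDSV.phaseIntegralBound_holds`, (C.1)), `energy_principalTerm_holds`, with the lemmas of
  `OnsagerBDSVEnergyPrincipal`, `OnsagerBDSVEnergyPrincipalTools`, `OnsagerBDSVEnergyPrincipalProofs`;
* `DeRosa.energyEstimate` (Prop. 5.12 in the shape of `BDSV.energyEstimate`, with
  `CoreHypotheses`), `energyEstimate_of_parts` (BDSV §6.2 assembly) and `energyEstimate_holds`
  (from the cross and corrector terms of `DeRosaPertCorrector.lean`);
* `DeRosa.energy_part` — part 5 of `DeRosa.perturbationStage_of_parts` (`DeRosa.energyPart`).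

## References

* L. De Rosa, Comm. PDE 44 (2019) 335–365 = arXiv:1801.10235, §5.5 Prop. 5.12. [`Derosa2018`]
* T. Buckmaster, C. De Lellis, L. Székelyhidi Jr., V. Vicol, CPAM 72 (2019) 229–274 =
  arXiv:1701.08678, Prop. 6.2, §6.2, App. C Prop. C.1. [`BuckmasterEtAl2018`]
-/

open MeasureTheory Set
open scoped NNReal ENNReal ContDiff Matrix Matrix.Norms.Elementwise
open scoped NNReal ENNReal ContDiff InnerProductSpace Matrix Matrix.Norms.Elementwise
open MeasureTheory Set Filter

noncomputable section

namespace Literature.Analysis.FluidPDE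

/-! ## Port of `OnsagerBDSVPerturbation` -/

namespace DeRosa

open BDSV

open FunctionSpaces FunctionSpaces.Torus

/-- The flat three-torus `T³ = (ℝ/ℤ)³`, local notation. -/
local notation "𝕋³" => UnitAddTorus (Fin 3)

/-- Euclidean `ℝ³`, local notation. -/
local notation "ℝ³" => EuclideanSpace ℝ (Fin 3)

/-- Real `3 × 3` matrices, local notation. -/
local notation "𝕄" => Matrix (Fin 3) (Fin 3) ℝ

section Facts

/-- **The energy estimate** (BDSV Prop. 6.2: "The energy of `v_{q+1}` satisfies
`|e(t) - ∫_{T³} |v_{q+1}|² dx - δ_{q+2}/2| ≲ δ_q^{1/2} δ_{q+1}^{1/2} λ_q^{1+2α} / λ_{q+1}`",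
for `t ∈ [0,T]`, the implicit constant as in Prop. 6.1, `a` sufficiently large; proof §6.2 via
`∑_i ∫ tr R_{q,i} = 3ρ_q`, (5.28) and the phase estimate (C.1) = (10.3)). Transcription as in
`BDSV.stressEstimate`. [cite: BuckmasterEtAl2018, Prop. 6.2] -/
def energyEstimate : Prop :=
  ∀ (𝔚 : MikadoDatum mikadoRadius) (c₀ : ℝ), 0 < c₀ → ∀ Cη : ℕ → ℕ → ℝ,
    ∀ β : ℝ, 0 < β → β < 1 / 3 → ∀ b : ℝ, 1 < b → b < (1 - β) / (2 * β) →
      ∃ α₀ : ℝ, 0 < α₀ ∧ ∀ α : ℝ, 0 < α → α < α₀ → ∃ Nbar : ℕ, ∀ Cin C₀ : ℝ,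
        ∃ C a₀ : ℝ, 1 < a₀ ∧ ∀ a : ℝ, a₀ ≤ a → ∀ S : Setting,
          CoreHypotheses ⟨β, α, a, b⟩ S Nbar Cin C₀ →
            ∀ 𝒟 : PerturbationData ⟨β, α, a, b⟩ S c₀ Cη,
              ∀ t ∈ Icc 0 S.T,
                |S.e t - (∫ x, ‖newVelocity ⟨β, α, a, b⟩ S 𝔚 𝒟.cut.η 𝒟.D t x‖ ^ 2) -
                    amp β a b (S.q + 2) / 2| ≤
                  C * (Real.sqrt (amp β a b S.q) * Real.sqrt (amp β a b (S.q + 1)) *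
                    freq a b S.q ^ (1 + 2 * α) * (freq a b (S.q + 1))⁻¹)

end Facts

end DeRosa

/-! ## Port of `OnsagerBDSVEnergy` -/

namespace DeRosa

open BDSV

open FunctionSpaces FunctionSpaces.Torus

/-- The flat three-torus `T³ = (ℝ/ℤ)³`, local notation. -/
local notation "𝕋³" => UnitAddTorus (Fin 3)

/-- Euclidean `ℝ³`, local notation. -/
local notation "ℝ³" => EuclideanSpace ℝ (Fin 3)

/-- Real `3 × 3` matrices, local notation. -/
local notation "𝕄" => Matrix (Fin 3) (Fin 3) ℝ

section Prefix

/-- `BDSV.energyEstimate` is the stage fact with body "(2.24c) = Prop. 6.2 on `[0,T]` with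
constant `C`" (definitionally). [cite: BuckmasterEtAl2018, Prop. 6.2] -/
theorem energyEstimate_iff_stageFact :
    energyEstimate ↔ StageFact fun 𝔚 P C S _ _ 𝒟 => ∀ t ∈ Icc 0 S.T,
      |S.e t - (∫ x, ‖newVelocity P S 𝔚 𝒟.cut.η 𝒟.D t x‖ ^ 2) - amp P.β P.a P.b (S.q + 2) / 2| ≤
        C * (Real.sqrt (amp P.β P.a P.b S.q) * Real.sqrt (amp P.β P.a P.b (S.q + 1)) *
          freq P.a P.b S.q ^ (1 + 2 * P.α) * (freq P.a P.b (S.q + 1))⁻¹) :=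
  Iff.rfl

variable {A B : MikadoDatum mikadoRadius → (P : Params) → ℝ → (S : Setting) → (c₀ : ℝ) →
    (Cη : ℕ → ℕ → ℝ) → PerturbationData P S c₀ Cη → Prop}

end Prefix

section Facts

/-- **The principal term of the energy** (BDSV, proof of Prop. 6.2, last paragraph: by the
expansion of `w_{o,i} ⊗ w_{o,i}` of §6.1.3,
`∫|w_o|² = ∑_i ∫ tr R_{q,i} + ∫ ∑_{i,k≠0} ρ_{q,i} tr(∇Φ_i⁻¹ C_k(R̃_{q,i}) ∇Φ_i⁻ᵀ) e^{iλ_{q+1}k·Φ_i}`,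
where `∑_i ∫ tr R_{q,i} = 3∑_i ∫ρ_{q,i} = 3ρ_q(t)`; with `e_{q,i} := ρ_{q,i} ∇Φ_i⁻¹ tr C_k(R̃_i) ∇Φ_i⁻ᵀ`,
"`‖e_{q,i}‖_N ≲ δ_{q+1} ℓ^{-N}`" (Prop. 5.7, Lemma 5.4), "at any given time at most two `e_{q,i}`
are nonvanishing", and (C.1) of Prop. C.2, the oscillatory term is
`≲ ∑_{k≠0} δ_{q+1} ℓ^{-N}/(λ_{q+1}^N |k|^N)`, where "we can choose `N` such that
`δ_{q+1} ℓ^{-N}/λ_{q+1}^N ≤ δ_{q+1} δ_q^{1/2} λ_q/λ_{q+1}`", `N > 4`, `a` large):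
`|∫_{T³} |w_o(x,t)|² dx - 3ρ_q(t)| ≲ δ_{q+1} δ_q^{1/2} λ_q λ_{q+1}⁻¹`, along the common prefix, for
`w_o = BDSV.principalPart` and every `t ∈ [0,T]`.
[cite: BuckmasterEtAl2018, Prop. 6.2 (proof, last paragraph) and Prop. C.2 (C.1)] -/
def energy_principalTerm : Prop :=
  StageFact fun 𝔚 P C S _ _ 𝒟 => ∀ t ∈ Icc 0 S.T,
    |(∫ x, ‖principalPart P S 𝔚 𝒟.cut.η 𝒟.D t x‖ ^ 2) - 3 * rhoQ P S t| ≤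
      C * (amp P.β P.a P.b (S.q + 1) * Real.sqrt (amp P.β P.a P.b S.q) * freq P.a P.b S.q *
        (freq P.a P.b (S.q + 1))⁻¹)

end Facts

section Smooth

variable {S' : Set ℝ}

variable {P : Params} {S : Setting} {η : ℕ → ℝ → 𝕋³ → ℝ} {D : ℕ → ℝ → 𝕋³ → ℝ³}

namespace SmoothData

variable (h : SmoothData P S η D)

end SmoothData

end Smooth

section Assembly

variable {β α a b : ℝ}

/-- **Assembly of the energy estimate from its parts** (BDSV, proof of Prop. 6.2): with the
bounds of Lemma 5.4 on `ρ_q` (G₀: `BDSV.stageFact_rhoQ_bounds`, from the proved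
`CoreHypotheses.le_rhoQ` / `.rhoQ_le`; it makes the construction smooth), the energy
identity `e - ∫|v_{q+1}|² - δ_{q+2}/2 = (3ρ_q - ∫|w_o|²) - 2∫ w_{q+1}·v̄_q - ∫(2w_o·w_c + |w_c|²)`
and the three estimates G₁ (cross term), G₂ (corrector terms), G₃ (principal term) give
Prop. 6.2 with constant `4 max(C, 0)` along the common prefix, after comparing the three scales
with `δ_q^{1/2} δ_{q+1}^{1/2} λ_q^{1+2α} λ_{q+1}^{-1}`. [cite: BuckmasterEtAl2018, Prop. 6.2 (proof)] -/
theorem energyEstimate_of_parts (h₁ : energy_crossTerm) (h₂ : energy_correctorTerm)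
    (h₃ : energy_principalTerm) : energyEstimate := by
  rw [energyEstimate_iff_stageFact]
  -- monotonicity of the bodies in the constant
  have m₁ : ∀ (𝔚 : MikadoDatum mikadoRadius) (P : Params) (C C' : ℝ) (S : Setting) (c₀ : ℝ)
      (Cη : ℕ → ℕ → ℝ) (𝒟 : PerturbationData P S c₀ Cη), 1 ≤ P.a → C ≤ C' →
      (∀ t ∈ Icc 0 S.T, |∫ x, ⟪perturbation P S 𝔚 𝒟.cut.η 𝒟.D t x, S.vbar t x⟫_ℝ| ≤
        C * (Real.sqrt (amp P.β P.a P.b S.q) * Real.sqrt (amp P.β P.a P.b (S.q + 1)) *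
          freq P.a P.b S.q * (freq P.a P.b (S.q + 1))⁻¹)) →
      ∀ t ∈ Icc 0 S.T, |∫ x, ⟪perturbation P S 𝔚 𝒟.cut.η 𝒟.D t x, S.vbar t x⟫_ℝ| ≤
        C' * (Real.sqrt (amp P.β P.a P.b S.q) * Real.sqrt (amp P.β P.a P.b (S.q + 1)) *
          freq P.a P.b S.q * (freq P.a P.b (S.q + 1))⁻¹) :=
    fun 𝔚 P C C' S c₀ Cη 𝒟 ha hCC' h t ht => (h t ht).trans
      (mul_le_mul_of_nonneg_right hCC' (mul_nonneg (mul_nonneg (mul_nonneg (Real.sqrt_nonneg _)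
        (Real.sqrt_nonneg _)) (freq_pos ha _).le) (inv_nonneg.2 (freq_pos ha _).le)))
  have m₂ : ∀ (𝔚 : MikadoDatum mikadoRadius) (P : Params) (C C' : ℝ) (S : Setting) (c₀ : ℝ)
      (Cη : ℕ → ℕ → ℝ) (𝒟 : PerturbationData P S c₀ Cη), 1 ≤ P.a → C ≤ C' →
      (∀ t ∈ Icc 0 S.T, |∫ x, (2 * ⟪principalPart P S 𝔚 𝒟.cut.η 𝒟.D t x,
          correctorPart P S 𝔚 𝒟.cut.η 𝒟.D t x⟫_ℝ + ‖correctorPart P S 𝔚 𝒟.cut.η 𝒟.D t x‖ ^ 2)| ≤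
        C * (amp P.β P.a P.b (S.q + 1) * (mollScale P.β P.α P.a P.b S.q)⁻¹ *
          (freq P.a P.b (S.q + 1))⁻¹)) →
      ∀ t ∈ Icc 0 S.T, |∫ x, (2 * ⟪principalPart P S 𝔚 𝒟.cut.η 𝒟.D t x,
          correctorPart P S 𝔚 𝒟.cut.η 𝒟.D t x⟫_ℝ + ‖correctorPart P S 𝔚 𝒟.cut.η 𝒟.D t x‖ ^ 2)| ≤
        C' * (amp P.β P.a P.b (S.q + 1) * (mollScale P.β P.α P.a P.b S.q)⁻¹ *
          (freq P.a P.b (S.q + 1))⁻¹) :=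
    fun 𝔚 P C C' S c₀ Cη 𝒟 ha hCC' h t ht => (h t ht).trans
      (mul_le_mul_of_nonneg_right hCC' (mul_nonneg (mul_nonneg (amp_pos ha _).le
        (inv_nonneg.2 (mollScale_pos ha _).le)) (inv_nonneg.2 (freq_pos ha _).le)))
  have m₃ : ∀ (𝔚 : MikadoDatum mikadoRadius) (P : Params) (C C' : ℝ) (S : Setting) (c₀ : ℝ)
      (Cη : ℕ → ℕ → ℝ) (𝒟 : PerturbationData P S c₀ Cη), 1 ≤ P.a → C ≤ C' →
      (∀ t ∈ Icc 0 S.T, |(∫ x, ‖principalPart P S 𝔚 𝒟.cut.η 𝒟.D t x‖ ^ 2) - 3 * rhoQ P S t| ≤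
        C * (amp P.β P.a P.b (S.q + 1) * Real.sqrt (amp P.β P.a P.b S.q) * freq P.a P.b S.q *
          (freq P.a P.b (S.q + 1))⁻¹)) →
      ∀ t ∈ Icc 0 S.T, |(∫ x, ‖principalPart P S 𝔚 𝒟.cut.η 𝒟.D t x‖ ^ 2) - 3 * rhoQ P S t| ≤
        C' * (amp P.β P.a P.b (S.q + 1) * Real.sqrt (amp P.β P.a P.b S.q) * freq P.a P.b S.q *
          (freq P.a P.b (S.q + 1))⁻¹) :=
    fun 𝔚 P C C' S c₀ Cη 𝒟 ha hCC' h t ht => (h t ht).trans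
      (mul_le_mul_of_nonneg_right hCC' (mul_nonneg (mul_nonneg (mul_nonneg (amp_pos ha _).le
        (Real.sqrt_nonneg _)) (freq_pos ha _).le) (inv_nonneg.2 (freq_pos ha _).le)))
  have hK := ((stageFact_rhoQ_bounds.and h₁ (fun _ _ _ _ _ _ _ _ _ _ h => h) m₁).and h₂
    (fun 𝔚 P C C' S c₀ Cη 𝒟 ha hle h => ⟨h.1, m₁ 𝔚 P C C' S c₀ Cη 𝒟 ha hle h.2⟩) m₂).and h₃
    (fun 𝔚 P C C' S c₀ Cη 𝒟 ha hle h =>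
      ⟨⟨h.1.1, m₁ 𝔚 P C C' S c₀ Cη 𝒟 ha hle h.1.2⟩, m₂ 𝔚 P C C' S c₀ Cη 𝒟 ha hle h.2⟩) m₃
  refine hK.mono (fun C => 4 * max C 0) ?_
  rintro 𝔚 P C S c₀ Cη 𝒟 hc₀ hβ - - hα ha ⟨Nbar, Cin, C₀, H⟩ ⟨⟨⟨hρ, hcross⟩, hcorr⟩, hprin⟩ t ht
  have ha1 : 1 ≤ P.a := ha.le
  -- `ρ_q > 0`, hence smooth data
  have hρpos : ∀ s ∈ Icc 0 S.T, 0 < rhoQ P S s := fun s hs =>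
    lt_of_lt_of_le (div_pos (mul_pos (amp_pos ha1 _) (Real.rpow_pos_of_pos (freq_pos ha1 _) _))
      (by norm_num)) (hρ s hs).1
  have hSD : SmoothData P S 𝒟.cut.η 𝒟.D := H.toSmoothData hc₀ 𝒟 hρpos
  -- the energy identity
  rw [hSD.integral_norm_sq_newVelocity 𝔚 ht]
  -- the three estimates and the scale comparisons
  set E := Real.sqrt (amp P.β P.a P.b S.q) * Real.sqrt (amp P.β P.a P.b (S.q + 1)) *
    freq P.a P.b S.q ^ (1 + 2 * P.α) * (freq P.a P.b (S.q + 1))⁻¹ with hE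
  have hE0 : 0 ≤ E := energyScale_nonneg ha1 S.q
  have hC : C ≤ max C 0 := le_max_left _ _
  have hC0 : 0 ≤ max C 0 := le_max_right _ _
  have hs₁ : C * (Real.sqrt (amp P.β P.a P.b S.q) * Real.sqrt (amp P.β P.a P.b (S.q + 1)) *
      freq P.a P.b S.q * (freq P.a P.b (S.q + 1))⁻¹) ≤ max C 0 * E :=
    (mul_le_mul_of_nonneg_right hC (mul_nonneg (mul_nonneg (mul_nonneg (Real.sqrt_nonneg _)
      (Real.sqrt_nonneg _)) (freq_pos ha1 _).le) (inv_nonneg.2 (freq_pos ha1 _).le))).trans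
      (mul_le_mul_of_nonneg_left (crossScale_le ha1 hα.le S.q) hC0)
  have hs₂ : C * (amp P.β P.a P.b (S.q + 1) * (mollScale P.β P.α P.a P.b S.q)⁻¹ *
      (freq P.a P.b (S.q + 1))⁻¹) ≤ max C 0 * E :=
    (mul_le_mul_of_nonneg_right hC (mul_nonneg (mul_nonneg (amp_pos ha1 _).le
      (inv_nonneg.2 (mollScale_pos ha1 _).le)) (inv_nonneg.2 (freq_pos ha1 _).le))).trans
      (mul_le_mul_of_nonneg_left (correctorScale_le ha1 hα.le S.q) hC0)
  have hs₃ : C * (amp P.β P.a P.b (S.q + 1) * Real.sqrt (amp P.β P.a P.b S.q) * freq P.a P.b S.q *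
      (freq P.a P.b (S.q + 1))⁻¹) ≤ max C 0 * E :=
    (mul_le_mul_of_nonneg_right hC (mul_nonneg (mul_nonneg (mul_nonneg (amp_pos ha1 _).le
      (Real.sqrt_nonneg _)) (freq_pos ha1 _).le) (inv_nonneg.2 (freq_pos ha1 _).le))).trans
      (mul_le_mul_of_nonneg_left (principalScale_le ha1 hα.le hβ.le S.q) hC0)
  obtain ⟨hX₁, hX₂⟩ := abs_le.mp ((hprin t ht).trans hs₃)
  obtain ⟨hI₁, hI₂⟩ := abs_le.mp ((hcross t ht).trans hs₁)
  obtain ⟨hJ₁, hJ₂⟩ := abs_le.mp ((hcorr t ht).trans hs₂)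
  have h3ρ := three_mul_rhoQ P S t
  rw [abs_le]
  constructor <;> nlinarith [h3ρ, hX₁, hX₂, hI₁, hI₂, hJ₁, hJ₂, hE0, hC0]

end Assembly

end DeRosa

/-! ## Port of `OnsagerBDSVEnergyPrincipal` -/

namespace DeRosa

open BDSV

open FunctionSpaces FunctionSpaces.Torus

/-- The flat three-torus `T³ = (ℝ/ℤ)³`, local notation. -/
local notation "𝕋³" => UnitAddTorus (Fin 3)

/-- Euclidean `ℝ³`, local notation. -/
local notation "ℝ³" => EuclideanSpace ℝ (Fin 3)

/-- Real `3 × 3` matrices, local notation. -/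
local notation "𝕄" => Matrix (Fin 3) (Fin 3) ℝ

section Fact

/-- **The oscillatory term of the energy is small** (BDSV, proof of Prop. 6.2, last paragraph:
with `e_{q,i} := ρ_{q,i} ∇Φ_i⁻¹ tr C_k(R̃_i) ∇Φ_i⁻ᵀ`, "use Proposition [5.7] and Lemma [5.4] to
conclude `‖e_{q,i}‖_N ≲ δ_{q+1} ℓ^{-N}`. Next observe that at any given time at most two `e_{q,i}`
are nonvanishing. Hence use [(C.1)] in Proposition [C.2] to bound
`|∫ ∑_i ∑_{k≠0} ρ_i ∇Φ_i⁻¹ tr C_k(R̃_i) ∇Φ_i⁻ᵀ e^{iλ_{q+1}k·Φ_i} dx| ≲ ∑_{k≠0} δ_{q+1}ℓ^{-N}/(λ_{q+1}^N |k|^N)`.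
As already argued several time, we can choose `N` such that
`δ_{q+1}ℓ^{-N}/λ_{q+1}^N ≤ δ_{q+1}δ_q^{1/2}λ_q/λ_{q+1}`. Assuming in addition that `N` is larger
than `4` (so that the series is summable), we obtain the desired estimate"): along the common
prefix, `|Osc(t)| ≤ C δ_{q+1} δ_q^{1/2} λ_q λ_{q+1}⁻¹` for every `t ∈ [0,T]` (`BDSV.oscTerm`).
The stationary-phase input (C.1) is the named fact `BDSV.phaseIntegralBound`
(`OnsagerBDSVStationaryPhase.lean`). [cite: BuckmasterEtAl2018, Prop. 6.2 (proof, last paragraph) and Prop. C.2 (C.1)] -/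
def energy_oscillatoryTerm : Prop :=
  StageFact fun 𝔚 P C S _ _ 𝒟 => ∀ t ∈ Icc 0 S.T,
    |oscTerm P S 𝔚 𝒟.cut.η 𝒟.D t| ≤
      C * (amp P.β P.a P.b (S.q + 1) * Real.sqrt (amp P.β P.a P.b S.q) * freq P.a P.b S.q *
        (freq P.a P.b (S.q + 1))⁻¹)

end Fact

section Identity

variable {P : Params} {S : Setting} {Nbar : ℕ} {Cin C₀ c₀ : ℝ} {Cη : ℕ → ℕ → ℝ}

/-- `tr(Id - c R̊̄_q) = 3` for the trace-free glued stress. [cite: BuckmasterEtAl2018, §5.2 (tr R_{q,i} = 3ρ_{q,i})] -/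
theorem trace_one_sub_smul_ofCols (H : CoreHypotheses P S Nbar Cin C₀) {t : ℝ}
    (ht : t ∈ Icc 0 S.T) (x : 𝕋³) (c : ℝ) :
    Matrix.trace ((1 : 𝕄) - c • ofCols (S.Rbar t x)) = 3 := by
  have htr : ∑ i, S.Rbar t x i i = 0 := H.eulerReynolds.traceFree t ht x
  rw [Matrix.trace_sub, Matrix.trace_smul, Matrix.trace_one, Fintype.card_fin, Matrix.trace]
  simp only [Matrix.diag_apply, ofCols_apply, Nat.cast_ofNat, htr, smul_zero, sub_zero]

/-- **The pointwise identity** behind `∫|w_o|² = ∑_i∫ tr R_{q,i} + (oscillatory term)`: under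
the standing hypotheses, for `a ≥ 1` (so that `det ∇Φ_i = 1`) and wherever `ρ_q/∑∫η² ≥ 0`,
`|w_o(t,x)|² = 3 ∑_i ρ_{q,i}(t,x) + e(t,x)` (`e = BDSV.oscIntegrand`).
[cite: BuckmasterEtAl2018, §6.1.3 (expansion of w_{o,i} ⊗ w_{o,i}) and §5.2 (tr R_{q,i} = 3ρ_{q,i})] -/
theorem PerturbationData.norm_sq_principalPart_eq (H : CoreHypotheses P S Nbar Cin C₀)
    (𝒟 : PerturbationData P S c₀ Cη) (𝔚 : MikadoDatum mikadoRadius) (ha : 1 ≤ P.a) {t : ℝ}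
    (ht : t ∈ Icc 0 S.T) (hq : 0 ≤ rhoQ P S t / etaMass P S 𝒟.cut.η t) (x : 𝕋³) :
    ‖principalPart P S 𝔚 𝒟.cut.η 𝒟.D t x‖ ^ 2 =
      3 * ∑ i ∈ Finset.range (cutoffCount S.T (P.τ S.q)), rhoI P S 𝒟.cut.η i t x +
        oscIntegrand P S 𝔚 𝒟.cut.η 𝒟.D t x := by
  -- shorthand for the summands of `w_o`
  set u : ℕ → ℝ³ := fun i => Matrix.toEuclideanLin (gradPhi 𝒟.D i t x).adjugate
    (𝔚.W (tildeR P S 𝒟.cut.η 𝒟.D i t x) (P.freqNat (S.q + 1) • phiPoint 𝒟.D i t x)) with hu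
  have hw : principalPart P S 𝔚 𝒟.cut.η 𝒟.D t x =
      ∑ i ∈ Finset.range (cutoffCount S.T (P.τ S.q)), sqrtRhoI P S 𝒟.cut.η i t x • u i := rfl
  -- at most one cut-off is active: the summands are pairwise orthogonal
  have horth : ∀ i ∈ Finset.range (cutoffCount S.T (P.τ S.q)),
      ∀ j ∈ Finset.range (cutoffCount S.T (P.τ S.q)), i ≠ j →
        ⟪sqrtRhoI P S 𝒟.cut.η i t x • u i, sqrtRhoI P S 𝒟.cut.η j t x • u j⟫_ℝ = 0 := by
    intro i _ j _ hij
    rcases 𝒟.cut.disjoint i j hij t x with h0 | h0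
    · simp only [sqrtRhoI, h0, zero_mul, zero_smul, inner_zero_left]
    · simp only [sqrtRhoI, h0, zero_mul, zero_smul, inner_zero_right]
  -- `(ρ_{q,i}^{1/2})² = ρ_{q,i}`
  have hsq : ∀ i, sqrtRhoI P S 𝒟.cut.η i t x ^ 2 = rhoI P S 𝒟.cut.η i t x := by
    intro i
    rw [sqrtRhoI, rhoI, mul_pow, Real.sq_sqrt hq]
  -- `det ∇Φ_i = 1`
  have hdet : ∀ i, (gradPhi 𝒟.D i t x).det = 1 := fun i => 𝒟.det_gradPhi_eq_one H ha i ht x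
  rw [hw, norm_sq_sum_eq_of_inner_eq_zero _ _ horth, oscIntegrand, Finset.mul_sum,
    ← Finset.sum_add_distrib]
  refine Finset.sum_congr rfl fun i _ => ?_
  rw [norm_smul, mul_pow, Real.norm_eq_abs, sq_abs, hsq, hu, norm_sq_toEuclideanLin_eq_trace]
  -- split `W ⊗ W = R̃ + (W ⊗ W - R̃)` and use `adj∇Φ R̃ adj∇Φᵀ = Id - c R̊̄`, `tr = 3`
  set G := gradPhi 𝒟.D i t x with hG
  set Rt := tildeR P S 𝒟.cut.η 𝒟.D i t x with hRt
  set WW : 𝕄 := Matrix.of (fun a b =>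
    𝔚.W Rt (P.freqNat (S.q + 1) • phiPoint 𝒟.D i t x) a *
      𝔚.W Rt (P.freqNat (S.q + 1) • phiPoint 𝒟.D i t x) b) with hWW
  have hfl : 𝔚.fluct Rt (P.freqNat (S.q + 1) • phiPoint 𝒟.D i t x) = WW - Rt := rfl
  have hsplit : WW = Rt + (WW - Rt) := by abel
  have hconj : G.adjugate * Rt * G.adjugateᵀ =
      (1 : 𝕄) - (etaMass P S 𝒟.cut.η t / rhoQ P S t) • ofCols (S.Rbar t x) := by
    rw [hRt, tildeR, ← hG, adjugate_mul_conj_mul_adjugate_transpose, hdet, mul_one, one_smul]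
  rw [hfl]
  conv_lhs => rw [hsplit]
  rw [Matrix.mul_add, Matrix.add_mul, Matrix.trace_add, hconj, trace_one_sub_smul_ofCols H ht x]
  ring

/-- **The energy of the principal part** (BDSV, proof of Prop. 6.2 with §6.1.3 and §5.2:
"`∫|w_o|² = ∑_i ∫ tr R_{q,i} + [oscillatory term]`", "`∑_i ∫ tr R_{q,i} = 3∑_i ∫ρ_{q,i} = 3ρ_q`"),
PROVED for the tree's objects: under the standing hypotheses with `c₀ > 0`, `a ≥ 1` and
`ρ_q(t) ≥ 0`, `∫_{T³} |w_o(x,t)|² dx = 3ρ_q(t) + Osc(t)` for `t ∈ [0,T]`.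
[cite: BuckmasterEtAl2018, Prop. 6.2 (proof) with §6.1.3] -/
theorem PerturbationData.integral_norm_sq_principalPart_eq (H : CoreHypotheses P S Nbar Cin C₀)
    (𝒟 : PerturbationData P S c₀ Cη) (𝔚 : MikadoDatum mikadoRadius) (hc₀ : 0 < c₀) (ha : 1 ≤ P.a)
    (hρ : ∀ s ∈ Icc 0 S.T, 0 < rhoQ P S s) {t : ℝ} (ht : t ∈ Icc 0 S.T) :
    ∫ x, ‖principalPart P S 𝔚 𝒟.cut.η 𝒟.D t x‖ ^ 2 = 3 * rhoQ P S t + oscTerm P S 𝔚 𝒟.cut.η 𝒟.D t := by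
  have hm : 0 < etaMass P S 𝒟.cut.η t := hc₀.trans_le (𝒟.le_etaMass ht)
  have hq : 0 ≤ rhoQ P S t / etaMass P S 𝒟.cut.η t := div_nonneg (hρ t ht).le hm.le
  have hSD : SmoothData P S 𝒟.cut.η 𝒟.D := H.toSmoothData hc₀ 𝒟 hρ
  -- integrability
  have hwo : IsSmooth (principalPart P S 𝔚 𝒟.cut.η 𝒟.D t) := (hSD.principalPart 𝔚).isSmooth_slice ht
  have hi₁ : Integrable (fun x => ‖principalPart P S 𝔚 𝒟.cut.η 𝒟.D t x‖ ^ 2) := hwo.norm_sq.integrable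
  have hρi : ∀ i, Integrable (fun x => rhoI P S 𝒟.cut.η i t x) := fun i =>
    ((hSD.rhoI i).isSmooth_slice ht).integrable
  have hi₂ : Integrable (fun x => 3 * ∑ i ∈ Finset.range (cutoffCount S.T (P.τ S.q)),
      rhoI P S 𝒟.cut.η i t x) :=
    (integrable_finsetSum _ fun i _ => hρi i).const_mul 3
  have hpt : (fun x => oscIntegrand P S 𝔚 𝒟.cut.η 𝒟.D t x) = fun x =>
      ‖principalPart P S 𝔚 𝒟.cut.η 𝒟.D t x‖ ^ 2 -
        3 * ∑ i ∈ Finset.range (cutoffCount S.T (P.τ S.q)), rhoI P S 𝒟.cut.η i t x := by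
    funext x
    rw [𝒟.norm_sq_principalPart_eq H 𝔚 ha ht hq x]
    ring
  have hi₃ : Integrable (fun x => oscIntegrand P S 𝔚 𝒟.cut.η 𝒟.D t x) := by
    rw [hpt]
    exact hi₁.sub hi₂
  -- integrate the pointwise identity
  have heq : (fun x => ‖principalPart P S 𝔚 𝒟.cut.η 𝒟.D t x‖ ^ 2) = fun x =>
      3 * ∑ i ∈ Finset.range (cutoffCount S.T (P.τ S.q)), rhoI P S 𝒟.cut.η i t x +
        oscIntegrand P S 𝔚 𝒟.cut.η 𝒟.D t x :=
    funext fun x => 𝒟.norm_sq_principalPart_eq H 𝔚 ha ht hq x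
  rw [heq, integral_add hi₂ hi₃, integral_const_mul, integral_finsetSum _ fun i _ => hρi i,
    𝒟.sum_integral_rhoI hm.ne', oscTerm]

end Identity

section Assembly

/-- **The principal term from the oscillatory term**: the named fact G₃
(`BDSV.energy_principalTerm`: `|∫|w_o|² - 3ρ_q| ≲ δ_{q+1} δ_q^{1/2} λ_q λ_{q+1}⁻¹`) follows from the
bound G₃′ on the oscillatory term (`BDSV.energy_oscillatoryTerm`), by the proved identity
`∫|w_o|² = 3ρ_q + Osc` (with `ρ_q > 0` along the prefix from `BDSV.stageFact_rhoQ_bounds`).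
[cite: BuckmasterEtAl2018, Prop. 6.2 (proof, last paragraph)] -/
theorem energy_principalTerm_of_oscillatoryTerm (h : energy_oscillatoryTerm) :
    energy_principalTerm := by
  have m : ∀ (𝔚 : MikadoDatum mikadoRadius) (P : Params) (C C' : ℝ) (S : Setting) (c₀ : ℝ)
      (Cη : ℕ → ℕ → ℝ) (𝒟 : PerturbationData P S c₀ Cη), 1 ≤ P.a → C ≤ C' →
      (∀ t ∈ Icc 0 S.T, |oscTerm P S 𝔚 𝒟.cut.η 𝒟.D t| ≤
        C * (amp P.β P.a P.b (S.q + 1) * Real.sqrt (amp P.β P.a P.b S.q) * freq P.a P.b S.q *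
          (freq P.a P.b (S.q + 1))⁻¹)) →
      ∀ t ∈ Icc 0 S.T, |oscTerm P S 𝔚 𝒟.cut.η 𝒟.D t| ≤
        C' * (amp P.β P.a P.b (S.q + 1) * Real.sqrt (amp P.β P.a P.b S.q) * freq P.a P.b S.q *
          (freq P.a P.b (S.q + 1))⁻¹) :=
    fun 𝔚 P C C' S c₀ Cη 𝒟 ha hCC' h t ht => (h t ht).trans
      (mul_le_mul_of_nonneg_right hCC' (mul_nonneg (mul_nonneg (mul_nonneg (amp_pos ha _).le
        (Real.sqrt_nonneg _)) (freq_pos ha _).le) (inv_nonneg.2 (freq_pos ha _).le)))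
  refine (stageFact_rhoQ_bounds.and h (fun _ _ _ _ _ _ _ _ _ _ h => h) m).mono (fun C => C) ?_
  rintro 𝔚 P C S c₀ Cη 𝒟 hc₀ - - - - ha ⟨Nbar, Cin, C₀, H⟩ ⟨hρ, hosc⟩ t ht
  have ha1 : 1 ≤ P.a := ha.le
  have hρpos : ∀ s ∈ Icc 0 S.T, 0 < rhoQ P S s := fun s hs =>
    lt_of_lt_of_le (div_pos (mul_pos (amp_pos ha1 _) (Real.rpow_pos_of_pos (freq_pos ha1 _) _))
      (by norm_num)) (hρ s hs).1
  rw [𝒟.integral_norm_sq_principalPart_eq H 𝔚 hc₀ ha1 hρpos ht, add_sub_cancel_left]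
  exact hosc t ht

end Assembly

end DeRosa

/-! ## Port of `OnsagerBDSVEnergyPrincipalTools` -/

namespace DeRosa

open BDSV

open FunctionSpaces FunctionSpaces.Torus

/-- The flat three-torus `T³ = (ℝ/ℤ)³`, local notation. -/
local notation "𝕋³" => UnitAddTorus (Fin 3)

/-- Euclidean `ℝ³`, local notation. -/
local notation "ℝ³" => EuclideanSpace ℝ (Fin 3)

/-- Real `3 × 3` matrices, local notation. -/
local notation "𝕄" => Matrix (Fin 3) (Fin 3) ℝ

section AllOrders

/-- **Prop. 5.7 (arXiv (5.23)) at all orders `k ≤ K` along one prefix**: the proved fact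
`BDSV.gradPhiBound` (`BDSV.gradPhiBound_holds`) delivers, for each `N`, a number of derivatives
`N̄(N)`, a constant and a threshold; taking maxima over `N ≤ K` gives one `N̄`, one constant `C` and
one threshold `a₀` for which `‖∇Φ_i‖_{C^k}, ‖(∇Φ_i)⁻¹‖_{C^k} ≤ C ℓ^{-k}` on `Ĩ_i` for every `k ≤ K`.
[cite: BuckmasterEtAl2018, Prop. 5.7 (arXiv (5.23))] -/
theorem gradPhiBound_allOrders :
    ∀ (c₀ : ℝ), 0 < c₀ → ∀ Cη : ℕ → ℕ → ℝ,
      ∀ β : ℝ, 0 < β → β < 1 / 3 → ∀ b : ℝ, 1 < b → b < (1 - β) / (2 * β) →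
        ∃ α₀ : ℝ, 0 < α₀ ∧ ∀ α : ℝ, 0 < α → α < α₀ → ∀ K : ℕ, ∃ Nbar : ℕ, ∀ Cin C₀ : ℝ,
          ∃ C a₀ : ℝ, 1 < a₀ ∧ ∀ a : ℝ, a₀ ≤ a → ∀ S : Setting,
            CoreHypotheses ⟨β, α, a, b⟩ S Nbar Cin C₀ →
              ∀ (𝒟 : PerturbationData ⟨β, α, a, b⟩ S c₀ Cη) (i : ℕ), ∀ k ≤ K,
                HolderSupOnLE (tildeInterval S.T (Params.τ ⟨β, α, a, b⟩ S.q) i)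
                    (fun t x => gradPhi 𝒟.D i t x) k 0
                    (C * mollScale β α a b S.q ^ (-(k : ℝ))) ∧
                  HolderSupOnLE (tildeInterval S.T (Params.τ ⟨β, α, a, b⟩ S.q) i)
                    (fun t x => (gradPhi 𝒟.D i t x)⁻¹) k 0
                    (C * mollScale β α a b S.q ^ (-(k : ℝ))) := by
  intro c₀ hc₀ Cη β hβ hβ' b hb hb'
  obtain ⟨α₀, hα₀, hG⟩ := gradPhiBound_holds c₀ hc₀ Cη β hβ hβ' b hb hb'
  refine ⟨α₀, hα₀, fun α hα hαlt => ?_⟩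
  have hGα := hG α hα hαlt
  intro K
  induction K with
  | zero =>
    obtain ⟨Nbar, hN⟩ := hGα 0
    refine ⟨Nbar, fun Cin C₀ => ?_⟩
    obtain ⟨C, a₀, ha₀, hC⟩ := hN Cin C₀
    refine ⟨C, a₀, ha₀, fun a ha S H 𝒟 i k hk => ?_⟩
    obtain rfl : k = 0 := Nat.le_zero.1 hk
    exact hC a ha S H 𝒟 i
  | succ K ih =>
    obtain ⟨N₁, h₁⟩ := ih
    obtain ⟨N₂, h₂⟩ := hGα (K + 1)
    refine ⟨max N₁ N₂, fun Cin C₀ => ?_⟩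
    obtain ⟨C₁, a₁, ha₁, hC₁⟩ := h₁ Cin C₀
    obtain ⟨C₂, a₂, ha₂, hC₂⟩ := h₂ Cin C₀
    refine ⟨max C₁ C₂, max a₁ a₂, lt_max_of_lt_left ha₁, fun a ha S H 𝒟 i k hk => ?_⟩
    have ha1 : (1 : ℝ) ≤ a := ha₁.le.trans ((le_max_left _ _).trans ha)
    have hℓk : 0 ≤ mollScale β α a b S.q ^ (-(k : ℝ)) :=
      Real.rpow_nonneg (mollScale_pos ha1 _).le _
    rcases Nat.lt_or_ge k (K + 1) with hlt | hge
    · have h := hC₁ a ((le_max_left _ _).trans ha) S (H.of_le (le_max_left _ _)) 𝒟 i k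
        (Nat.lt_succ_iff.1 hlt)
      exact ⟨h.1.mono (mul_le_mul_of_nonneg_right (le_max_left _ _) hℓk),
        h.2.mono (mul_le_mul_of_nonneg_right (le_max_left _ _) hℓk)⟩
    · obtain rfl : k = K + 1 := le_antisymm hk hge
      have h := hC₂ a ((le_max_right _ _).trans ha) S (H.of_le (le_max_right _ _)) 𝒟 i
      exact ⟨h.1.mono (mul_le_mul_of_nonneg_right (le_max_right _ _) hℓk),
        h.2.mono (mul_le_mul_of_nonneg_right (le_max_right _ _) hℓk)⟩

end AllOrders

section Frame

variable {P : Params} {S : Setting} {Nbar : ℕ} {Cin C₀ c₀ : ℝ} {Cη : ℕ → ℕ → ℝ}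

/-- The smooth slice `x ↦ ∇Φ_i(t, x)` (as a matrix field) under the standing hypotheses. [folklore] -/
theorem PerturbationData.isSmooth_gradPhi (H : CoreHypotheses P S Nbar Cin C₀)
    (𝒟 : PerturbationData P S c₀ Cη) (i : ℕ) {t : ℝ} (ht : t ∈ Icc 0 S.T) :
    IsSmooth fun x => gradPhi 𝒟.D i t x :=
  isSmooth_matrix_of_entries fun a b =>
    (isSmoothSpaceTimeOn_gradPhi H.pos_T (fun j => (𝒟.flow j).smooth) i a b).isSmooth_slice ht

/-- The slice `x ↦ R̃_{q,i}(t, x)` is smooth (for `ρ_q ≠ 0` on `[0,T]`). [folklore] -/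
theorem PerturbationData.isSmooth_tildeR (H : CoreHypotheses P S Nbar Cin C₀)
    (𝒟 : PerturbationData P S c₀ Cη) (hρ : ∀ s ∈ Icc 0 S.T, rhoQ P S s ≠ 0) (i : ℕ) {t : ℝ}
    (ht : t ∈ Icc 0 S.T) : IsSmooth fun x => tildeR P S 𝒟.cut.η 𝒟.D i t x :=
  isSmooth_matrix_of_entries fun a b =>
    (isSmoothSpaceTimeOn_tildeR H.pos_T H.profile.smooth H.eulerReynolds.smooth_velocity
      H.eulerReynolds.smooth_stress 𝒟.cut.smooth (fun j => (𝒟.flow j).smooth) hρ i a b).isSmooth_slice ht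

/-- With `det ∇Φ_i = 1`, the matrix inverse `(∇Φ_i)⁻¹` is the adjugate. [folklore] -/
theorem PerturbationData.gradPhi_inv_eq_adjugate (H : CoreHypotheses P S Nbar Cin C₀)
    (𝒟 : PerturbationData P S c₀ Cη) (ha : 1 ≤ P.a) (i : ℕ) {t : ℝ} (ht : t ∈ Icc 0 S.T) :
    (fun x => (gradPhi 𝒟.D i t x)⁻¹) = fun x => (gradPhi 𝒟.D i t x).adjugate := by
  funext x
  rw [Matrix.inv_def, 𝒟.det_gradPhi_eq_one H ha i ht x, Ring.inverse_one, one_smul]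

/-- **Scaled bounds on the entries of the glued stress** from (2.20): `‖R̊̄_{lk}(t)‖_{C^k} ≤ 3 C_in δ_{q+1} ℓ^α · ℓ^{-k}`
for `k ≤ K ≤ N̄`. [cite: BuckmasterEtAl2018, §2.5 (2.20)] -/
theorem CoreHypotheses.scaledBound_Rbar (H : CoreHypotheses P S Nbar Cin C₀)
    (ha : 1 ≤ P.a) {K : ℕ} (hK : K ≤ Nbar) {t : ℝ} (ht : t ∈ Icc 0 S.T) (l k : Fin 3) :
    ScaledBound (fun x => S.Rbar t x l k) K (mollScale P.β P.α P.a P.b S.q)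
      (3 * (Cin * (amp P.β P.a P.b (S.q + 1) * mollScale P.β P.α P.a P.b S.q ^ P.α))) := by
  intro j hj
  have hℓ := mollScale_pos (β := P.β) (α := P.α) (b := P.b) ha S.q
  have hRs : IsSmooth (S.Rbar t) := H.eulerReynolds.smooth_stress.isSmooth_slice ht
  have hs := H.stress j (hj.trans hK) t ht
  calc Torus.eContDiffHolderNorm j 0 (fun x => S.Rbar t x l k)
      ≤ 3 * Torus.eContDiffHolderNorm j (Real.toNNReal P.α) (fun x => S.Rbar t x l k) :=
        Torus.eContDiffHolderNorm_exponent_zero_le j _ _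
    _ ≤ 3 * Torus.eContDiffHolderNorm j (Real.toNNReal P.α) (S.Rbar t) :=
        mul_le_mul' le_rfl (eContDiffHolderNorm_colEntry_le (hRs.isContDiff (by exact_mod_cast le_top)) _ l k)
    _ ≤ 3 * ENNReal.ofReal (Cin * (amp P.β P.a P.b (S.q + 1) *
          mollScale P.β P.α P.a P.b S.q ^ (-(j : ℝ) + P.α))) := mul_le_mul' le_rfl hs
    _ = ENNReal.ofReal (3 * (Cin * (amp P.β P.a P.b (S.q + 1) * mollScale P.β P.α P.a P.b S.q ^ P.α)) *
          (mollScale P.β P.α P.a P.b S.q)⁻¹ ^ j) := by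
        rw [← ENNReal.ofReal_ofNat 3, ← ENNReal.ofReal_mul (by norm_num), Real.rpow_add hℓ,
          rpow_neg_natCast_eq_inv_pow hℓ]
        ring_nf

/-- **Scaled bounds on the entries of `R̃_{q,i}`** (the content of Prop. 5.7, arXiv (5.24):
`‖R̃_{q,i}‖_N ≲ ℓ^{-N}`): from the all-orders bounds `‖∇Φ_i(t)‖_{C^k} ≤ C_J ℓ^{-k}` (`k ≤ K`),
(2.20) for `k ≤ K ≤ N̄`, `4δ_{q+2} ≤ δ_{q+1}λ_q^{-α}` and `λ_q^αℓ^α ≤ 1`, by the Leibniz rule for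
`R̃ = ∇Φ (Id - c R̊̄) ∇Φᵀ`. [cite: BuckmasterEtAl2018, Prop. 5.7 (arXiv (5.24))] -/
theorem PerturbationData.scaledBound_tildeR (H : CoreHypotheses P S Nbar Cin C₀)
    (𝒟 : PerturbationData P S c₀ Cη) (hCin : 0 ≤ Cin) (ha : 1 ≤ P.a) (hb : 1 ≤ P.b) (hβ : 0 ≤ P.β)
    (hα : 0 ≤ P.α)
    (h4 : 4 * amp P.β P.a P.b (S.q + 2) ≤ amp P.β P.a P.b (S.q + 1) * freq P.a P.b S.q ^ (-P.α))
    {K : ℕ} (hK : K ≤ Nbar) {CJ : ℝ} (hCJ : 0 ≤ CJ) {i : ℕ} {t : ℝ} (ht : t ∈ Icc 0 S.T)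
    (hJ : ∀ k ≤ K, Torus.eContDiffHolderNorm k 0 (fun x => gradPhi 𝒟.D i t x) ≤
      ENNReal.ofReal (CJ * mollScale P.β P.α P.a P.b S.q ^ (-(k : ℝ))))
    (a b : Fin 3) :
    ScaledBound (fun x => tildeR P S 𝒟.cut.η 𝒟.D i t x a b) K (mollScale P.β P.α P.a P.b S.q)
      (9 * ((3 : ℝ) ^ K * (K + 1)) ^ 2 * CJ ^ 2 * (1 + 24 * Cin)) := by
  set ℓ := mollScale P.β P.α P.a P.b S.q with hℓdef
  have hℓ : 0 < ℓ := mollScale_pos ha _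
  have hℓ1 : ℓ ≤ 1 := (one_le_inv₀ hℓ).1 (one_le_mollScale_inv ha hb hβ hα _)
  have hδ : 0 < amp P.β P.a P.b (S.q + 1) := amp_pos ha _
  set c : ℝ := etaMass P S 𝒟.cut.η t / rhoQ P S t with hcdef
  obtain ⟨hc0, hcle⟩ := 𝒟.etaMass_div_rhoQ_le H ha h4 ht
  -- the players and their smoothness
  have hJs : IsSmooth fun x => gradPhi 𝒟.D i t x := 𝒟.isSmooth_gradPhi H i ht
  have hJe : ∀ p q : Fin 3, IsSmooth fun x => gradPhi 𝒟.D i t x p q := fun p q => isSmooth_entry hJs p q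
  have hRs : IsSmooth (S.Rbar t) := H.eulerReynolds.smooth_stress.isSmooth_slice ht
  have hRe : ∀ l k : Fin 3, IsSmooth fun x => S.Rbar t x l k := fun l k =>
    (hRs.comp_clm (ContinuousLinearMap.proj (R := ℝ) (φ := fun _ : Fin 3 => ℝ³) l)).apply k
  -- scaled bounds: `∇Φ`, the middle matrix `M = Id - c R̊̄ᵀ`
  have hJB : ∀ p q : Fin 3, ScaledBound (fun x => gradPhi 𝒟.D i t x p q) K ℓ CJ := fun p q =>
    scaledBound_entry hJs hℓ hJ p q
  set M₀ : ℝ := 1 + 24 * Cin with hM₀def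
  have hM₀ : 0 ≤ M₀ := by positivity
  have hMB : ∀ k l : Fin 3, ScaledBound (fun x => (1 : 𝕄) k l - c * S.Rbar t x l k) K ℓ M₀ := by
    intro k l
    have h1 : ScaledBound (fun _ : 𝕋³ => (1 : 𝕄) k l) K ℓ 1 := by
      refine (scaledBound_const ((1 : 𝕄) k l) K hℓ hℓ1).mono_M ?_ hℓ
      rw [Matrix.one_apply]
      split_ifs <;> simp
    have h2 : ScaledBound (fun x => c * S.Rbar t x l k) K ℓ (24 * Cin) := by
      have h3 := (H.scaledBound_Rbar ha hK ht l k).const_mul (hRe l k) c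
      refine h3.mono_M ?_ hℓ
      rw [abs_of_nonneg hc0]
      have hX := freq_rpow_mul_mollScale_rpow_le_one_of_nonneg ha hb hβ hα S.q (β := P.β) (α := P.α)
      calc c * (3 * (Cin * (amp P.β P.a P.b (S.q + 1) * ℓ ^ P.α)))
          ≤ (8 * freq P.a P.b S.q ^ P.α / amp P.β P.a P.b (S.q + 1)) *
              (3 * (Cin * (amp P.β P.a P.b (S.q + 1) * ℓ ^ P.α))) :=
            mul_le_mul_of_nonneg_right hcle (by positivity)
        _ = 24 * Cin * (freq P.a P.b S.q ^ P.α * ℓ ^ P.α) := by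
            rw [div_mul_eq_mul_div, div_eq_iff hδ.ne']
            ring
        _ ≤ 24 * Cin * 1 := mul_le_mul_of_nonneg_left hX (by positivity)
        _ = 24 * Cin := mul_one _
    have h4' := h1.sub h2 (isSmooth_const _) ((isSmooth_const _).mul (hRe l k)) zero_le_one
      (by positivity) hℓ
    exact h4'
  have hMs : ∀ k l : Fin 3, IsSmooth fun x => (1 : 𝕄) k l - c * S.Rbar t x l k := fun k l =>
    (isSmooth_const _).sub ((isSmooth_const _).mul (hRe l k))
  -- the entry of `R̃ = J M Jᵀ`
  set c₁ : ℝ := (3 : ℝ) ^ K * (K + 1) with hc₁def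
  have hc₁ : 0 ≤ c₁ := by positivity
  have hinner : ∀ l : Fin 3, ScaledBound
      (fun x => ∑ k, gradPhi 𝒟.D i t x a k * ((1 : 𝕄) k l - c * S.Rbar t x l k)) K ℓ
      (3 * (c₁ * CJ * M₀)) := by
    intro l
    have h := ScaledBound.sum (Finset.univ : Finset (Fin 3))
      (f := fun k x => gradPhi 𝒟.D i t x a k * ((1 : 𝕄) k l - c * S.Rbar t x l k))
      (fun k _ => (hJB a k).mul (hMB k l) (hJe a k) (hMs k l) hCJ hM₀ hℓ)
      (fun k _ => (hJe a k).mul (hMs k l)) (by positivity) hℓ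
    simp only [Finset.card_univ, Fintype.card_fin, Nat.cast_ofNat] at h
    refine h.mono_M (le_of_eq ?_) hℓ
    rw [hc₁def]
  have hinner_s : ∀ l : Fin 3, IsSmooth
      (fun x => ∑ k, gradPhi 𝒟.D i t x a k * ((1 : 𝕄) k l - c * S.Rbar t x l k)) := fun l =>
    Torus.isSmooth_finset_sum _ fun k _ => (hJe a k).mul (hMs k l)
  have houter := ScaledBound.sum (Finset.univ : Finset (Fin 3))
    (f := fun l x => (∑ k, gradPhi 𝒟.D i t x a k * ((1 : 𝕄) k l - c * S.Rbar t x l k)) *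
      gradPhi 𝒟.D i t x b l)
    (fun l _ => (hinner l).mul (hJB b l) (hinner_s l) (hJe b l) (by positivity) hCJ hℓ)
    (fun l _ => (hinner_s l).mul (hJe b l)) (by positivity) hℓ
  simp only [Finset.card_univ, Fintype.card_fin, Nat.cast_ofNat] at houter
  have heq : (fun x => tildeR P S 𝒟.cut.η 𝒟.D i t x a b) = fun x => ∑ l,
      (∑ k, gradPhi 𝒟.D i t x a k * ((1 : 𝕄) k l - c * S.Rbar t x l k)) * gradPhi 𝒟.D i t x b l := by
    funext x
    simp only [tildeR, Matrix.mul_apply, Matrix.transpose_apply, Matrix.sub_apply, Matrix.smul_apply,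
      ofCols_apply, smul_eq_mul, hcdef]
  rw [heq]
  refine houter.mono_M (le_of_eq ?_) hℓ
  rw [hc₁def]
  ring

/-- **The phase frame of the construction**: under the standing hypotheses with `C_in ≥ 0`,
`a ≥ 1`, the parameter conditions of Lemma 5.4 (`4δ_{q+2} ≤ δ_{q+1}λ_q^{-α}`, the deformation
and stress thresholds) and the all-orders bounds
`‖∇Φ_i(t)‖_{C^k}, ‖∇Φ_i(t)⁻¹‖_{C^k} ≤ C_J ℓ^{-k}` (`k ≤ K ≤ N̄`) at a time `t ∈ [0,T]` at which
`η_i(t,·)` does not vanish identically, the data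
`(R̃_{q,i}(t,·), D_i(t,·), n_{q+1}, K, ℓ, Λ, B̄(Id, 1/10))` form a `BDSV.PhaseFrame` with
`Λ = BDSV.frameConst K C_J C_in`. [cite: BuckmasterEtAl2018, Lemma 5.4 and Prop. 5.7] -/
theorem PerturbationData.phaseFrame (H : CoreHypotheses P S Nbar Cin C₀)
    (𝒟 : PerturbationData P S c₀ Cη) (hCin : 0 ≤ Cin) (ha : 1 ≤ P.a) (hb : 1 ≤ P.b) (hβ : 0 ≤ P.β)
    (hα : 0 ≤ P.α)
    (h4 : 4 * amp P.β P.a P.b (S.q + 2) ≤ amp P.β P.a P.b (S.q + 1) * freq P.a P.b S.q ^ (-P.α))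
    (hdef : Real.exp (4 * (Cin * mollScale P.β P.α P.a P.b S.q ^ (2 * P.α))) - 1 ≤ 1 / 300)
    (hstr : 8 * (Cin * (freq P.a P.b S.q ^ P.α * mollScale P.β P.α P.a P.b S.q ^ P.α)) ≤ 1 / 100)
    {K : ℕ} (hK : K ≤ Nbar) {CJ : ℝ} (hCJ : 0 ≤ CJ) {i : ℕ} {t : ℝ} (ht : t ∈ Icc 0 S.T)
    (hJ : ∀ k ≤ K, Torus.eContDiffHolderNorm k 0 (fun x => gradPhi 𝒟.D i t x) ≤
      ENNReal.ofReal (CJ * mollScale P.β P.α P.a P.b S.q ^ (-(k : ℝ))))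
    (hJinv : ∀ k ≤ K, Torus.eContDiffHolderNorm k 0 (fun x => (gradPhi 𝒟.D i t x)⁻¹) ≤
      ENNReal.ofReal (CJ * mollScale P.β P.α P.a P.b S.q ^ (-(k : ℝ))))
    {x' : 𝕋³} (hη : 𝒟.cut.η i t x' ≠ 0) :
    PhaseFrame (fun x => tildeR P S 𝒟.cut.η 𝒟.D i t x) (𝒟.D i t) (P.freqNat (S.q + 1)) K
      (mollScale P.β P.α P.a P.b S.q) (frameConst K CJ Cin)
      (Metric.closedBall (1 : 𝕄) mikadoRadius) := by
  have hℓ : 0 < mollScale P.β P.α P.a P.b S.q := mollScale_pos ha _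
  have hρpos : ∀ s ∈ Icc 0 S.T, 0 < rhoQ P S s := fun s hs =>
    lt_of_lt_of_le (div_pos (mul_pos (amp_pos ha _) (Real.rpow_pos_of_pos (freq_pos ha _) _))
      (by norm_num)) (H.le_rhoQ h4 hs)
  obtain ⟨hΛ1, hΛJ, hΛR⟩ := frameConst_bounds K hCJ hCin
  have hJs : IsSmooth fun x => gradPhi 𝒟.D i t x := 𝒟.isSmooth_gradPhi H i ht
  have hadj : ∀ m j, ScaledBound (fun x => (jac (𝒟.D i t) x).adjugate m j) K
      (mollScale P.β P.α P.a P.b S.q) CJ := by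
    intro m j
    have hinv_s : IsSmooth fun x => (gradPhi 𝒟.D i t x)⁻¹ := by
      rw [𝒟.gradPhi_inv_eq_adjugate H ha i ht]
      exact isSmooth_matrix_of_entries fun p q =>
        isSmooth_adjugate_jac_entry ((𝒟.flow i).smooth.isSmooth_slice ht) p q
    have h := scaledBound_entry hinv_s hℓ hJinv m j
    have heq : (fun x => (gradPhi 𝒟.D i t x)⁻¹ m j) = fun x => (jac (𝒟.D i t) x).adjugate m j := by
      funext x
      have := congrFun (𝒟.gradPhi_inv_eq_adjugate H ha i ht) x
      rw [this]
      rfl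
    rw [heq] at h
    exact h
  exact
    { smooth_Rt := 𝒟.isSmooth_tildeR H (fun s hs => (hρpos s hs).ne') i ht
      smooth_D := (𝒟.flow i).smooth.isSmooth_slice ht
      n_pos := P.freqNat_pos ha _
      ℓ_pos := hℓ
      ℓ_le_one := (one_le_inv₀ hℓ).1 (one_le_mollScale_inv ha hb hβ hα _)
      one_le_Λ := hΛ1
      det_jac := fun x => 𝒟.det_gradPhi_eq_one H ha i ht x
      adj_bound := fun m j => (hadj m j).mono_M hΛJ hℓ
      Rt_bound := fun a b =>
        (𝒟.scaledBound_tildeR H hCin ha hb hβ hα h4 hK hCJ ht hJ a b).mono_M hΛR hℓ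
      isCompact := isCompact_closedBall _ _
      mem := fun x => 𝒟.tildeR_mem_closedBall H hCin ha hdef hstr h4 ht hη x }

end Frame

end DeRosa

/-! ## Port of `OnsagerBDSVEnergyPrincipalProofs` -/

namespace DeRosa

open BDSV

open FunctionSpaces FunctionSpaces.Torus

/-- The flat three-torus `T³ = (ℝ/ℤ)³`, local notation. -/
local notation "𝕋³" => UnitAddTorus (Fin 3)

/-- Euclidean `ℝ³`, local notation. -/
local notation "ℝ³" => EuclideanSpace ℝ (Fin 3)

/-- Real `3 × 3` matrices, local notation. -/
local notation "𝕄" => Matrix (Fin 3) (Fin 3) ℝ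

section TermI

variable {P : Params} {S : Setting} {Nbar : ℕ} {Cin C₀ c₀ : ℝ} {Cη : ℕ → ℕ → ℝ}

/-- **The bound on the `i`-th summand at an active time** (the heart of the last paragraph of
the proof of Prop. 6.2): in the phase frame of the construction, with `U` a uniform bound for the
level-`K` descendants of the mean-free Mikado tensor on `B̄(Id,1/10) × T³`,
`|∫ ρ_i tr(A G Aᵀ)| ≤ 27 X^K F U`, `X = phaseConst K · Λ² · (n_{q+1}ℓ)⁻¹`,
`F = (3^K(K+1))³ Λ² (∑_{k≤K}|C_η(0,k)|)² δ_{q+1}/c₀`.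
[cite: BuckmasterEtAl2018, Prop. 6.2 (proof, last paragraph)] -/
theorem PerturbationData.abs_oscTermI_le (H : CoreHypotheses P S Nbar Cin C₀)
    (𝒟 : PerturbationData P S c₀ Cη) (𝔚 : MikadoDatum mikadoRadius) (hc₀ : 0 < c₀) (hCin : 0 ≤ Cin)
    (ha : 1 ≤ P.a) (hb : 1 ≤ P.b) (hβ : 0 ≤ P.β) (hα : 0 ≤ P.α)
    (h4 : 4 * amp P.β P.a P.b (S.q + 2) ≤ amp P.β P.a P.b (S.q + 1) * freq P.a P.b S.q ^ (-P.α))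
    (hdef : Real.exp (4 * (Cin * mollScale P.β P.α P.a P.b S.q ^ (2 * P.α))) - 1 ≤ 1 / 300)
    (hstr : 8 * (Cin * (freq P.a P.b S.q ^ P.α * mollScale P.β P.α P.a P.b S.q ^ P.α)) ≤ 1 / 100)
    {K : ℕ} (hK : K ≤ Nbar) {CJ : ℝ} (hCJ : 0 ≤ CJ) {i : ℕ} {t : ℝ} (ht : t ∈ Icc 0 S.T)
    (hJ : ∀ k ≤ K, Torus.eContDiffHolderNorm k 0 (fun x => gradPhi 𝒟.D i t x) ≤
      ENNReal.ofReal (CJ * mollScale P.β P.α P.a P.b S.q ^ (-(k : ℝ))))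
    (hJinv : ∀ k ≤ K, Torus.eContDiffHolderNorm k 0 (fun x => (gradPhi 𝒟.D i t x)⁻¹) ≤
      ENNReal.ofReal (CJ * mollScale P.β P.α P.a P.b S.q ^ (-(k : ℝ))))
    {x' : 𝕋³} (hη : 𝒟.cut.η i t x' ≠ 0) {U : ℝ} (hU0 : 0 ≤ U)
    (hU : ∀ a b, ∀ v ∈ descSet K (𝔚.fluctZ a b), ∀ R ∈ Metric.closedBall (1 : 𝕄) mikadoRadius,
      ∀ ξ, |v R ξ| ≤ U) :
    |oscTermI P S 𝔚 𝒟.cut.η 𝒟.D i t| ≤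
      27 * ((phaseConst K * frameConst K CJ Cin ^ 2 *
        ((P.freqNat (S.q + 1) : ℝ) * mollScale P.β P.α P.a P.b S.q)⁻¹) ^ K *
        ((3 : ℝ) ^ K * (K + 1) * (3 ^ K * (K + 1) * (amp P.β P.a P.b (S.q + 1) / c₀ *
          (3 ^ K * (K + 1) * (∑ k ∈ Finset.range (K + 1), |Cη 0 k|) ^ 2)) *
            frameConst K CJ Cin) * frameConst K CJ Cin) * U) := by
  -- notation
  set ℓ := mollScale P.β P.α P.a P.b S.q with hℓdef
  set n : ℕ := P.freqNat (S.q + 1) with hndef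
  set Λ := frameConst K CJ Cin with hΛdef
  set Cη' : ℝ := ∑ k ∈ Finset.range (K + 1), |Cη 0 k| with hCη'
  set c₁ : ℝ := (3 : ℝ) ^ K * (K + 1) with hc₁def
  set δ := amp P.β P.a P.b (S.q + 1) with hδdef
  set Rt : 𝕋³ → 𝕄 := fun x => tildeR P S 𝒟.cut.η 𝒟.D i t x with hRtdef
  have hℓ : 0 < ℓ := mollScale_pos ha _
  have hli : 1 ≤ ℓ⁻¹ := one_le_mollScale_inv ha hb hβ hα _
  have hδ : 0 < δ := amp_pos ha _
  have hc₁ : 0 ≤ c₁ := by positivity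
  have hCη'0 : 0 ≤ Cη' := Finset.sum_nonneg fun k _ => abs_nonneg _
  -- the frame
  have hP : PhaseFrame Rt (𝒟.D i t) n K ℓ Λ (Metric.closedBall (1 : 𝕄) mikadoRadius) :=
    𝒟.phaseFrame H hCin ha hb hβ hα h4 hdef hstr hK hCJ ht hJ hJinv hη
  have hΛ0 : 0 ≤ Λ := zero_le_one.trans hP.one_le_Λ
  have hρpos : ∀ s ∈ Icc 0 S.T, 0 < rhoQ P S s := fun s hs =>
    lt_of_lt_of_le (div_pos (mul_pos (amp_pos ha _) (Real.rpow_pos_of_pos (freq_pos ha _) _))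
      (by norm_num)) (H.le_rhoQ h4 hs)
  have hSD : SmoothData P S 𝒟.cut.η 𝒟.D := H.toSmoothData hc₀ 𝒟 hρpos
  -- the amplitude `ρ_i A_{ca} A_{cb}` and its scaled bound
  set sc : ℝ := rhoQ P S t / etaMass P S 𝒟.cut.η t with hscdef
  have hsc0 : 0 ≤ sc := div_nonneg (hρpos t ht).le (hc₀.le.trans (𝒟.le_etaMass ht))
  have hsc : sc ≤ δ / c₀ := div_le_div₀ hδ.le (H.rhoQ_le ha ht) hc₀ (𝒟.le_etaMass ht)
  have hηs : IsSmooth (𝒟.cut.η i t) := (𝒟.cut.smooth i).isSmooth_slice ht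
  have hηB : ScaledBound (𝒟.cut.η i t) K ℓ Cη' := by
    intro k hk
    have h := 𝒟.cut.deriv_le i 0 k t ht
    simp only [Function.iterate_zero, id_eq, Nat.cast_zero, neg_zero, Real.rpow_zero, mul_one] at h
    refine h.trans (ENNReal.ofReal_le_ofReal ?_)
    have h1 : Cη 0 k ≤ Cη' := (le_abs_self _).trans
      (Finset.single_le_sum (f := fun k => |Cη 0 k|) (fun _ _ => abs_nonneg _)
        (Finset.mem_range.2 (Nat.lt_succ_of_le hk)))
    exact h1.trans (le_mul_of_one_le_right hCη'0 (one_le_pow₀ hli))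
  have hρs : IsSmooth (rhoI P S 𝒟.cut.η i t) := (hSD.rhoI i).isSmooth_slice ht
  have hρB : ScaledBound (rhoI P S 𝒟.cut.η i t) K ℓ (δ / c₀ * (c₁ * Cη' ^ 2)) := by
    have e : rhoI P S 𝒟.cut.η i t = fun x => sc * (𝒟.cut.η i t x * 𝒟.cut.η i t x) := by
      funext x
      rw [rhoI, hscdef]
      ring
    have h := ((hηB.mul hηB hηs hηs hCη'0 hCη'0 hℓ).const_mul (hηs.mul hηs) sc)
    rw [e]
    refine h.mono_M ?_ hℓ
    rw [abs_of_nonneg hsc0, hc₁def]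
    have : 0 ≤ (3 : ℝ) ^ K * (K + 1) * Cη' * Cη' := by positivity
    nlinarith
  have hA : ∀ m j, IsSmooth fun x => (jac (𝒟.D i t) x).adjugate m j := fun m j =>
    isSmooth_adjugate_jac_entry hP.smooth_D m j
  set F : ℝ := c₁ * (c₁ * (δ / c₀ * (c₁ * Cη' ^ 2)) * Λ) * Λ with hFdef
  have hF : 0 ≤ F := by positivity
  have hfs : ∀ c a b, IsSmooth fun x => rhoI P S 𝒟.cut.η i t x * (jac (𝒟.D i t) x).adjugate c a *
      (jac (𝒟.D i t) x).adjugate c b := fun c a b => (hρs.mul (hA c a)).mul (hA c b)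
  have hfB : ∀ c a b, ScaledBound (fun x => rhoI P S 𝒟.cut.η i t x * (jac (𝒟.D i t) x).adjugate c a *
      (jac (𝒟.D i t) x).adjugate c b) K ℓ F := by
    intro c a b
    have h1 := hρB.mul (hP.adj_bound c a) hρs (hA c a) (by positivity) hΛ0 hℓ
    have h2 := h1.mul (hP.adj_bound c b) (hρs.mul (hA c a)) (hA c b) (by positivity) hΛ0 hℓ
    refine h2.mono_M (le_of_eq ?_) hℓ
    rw [hFdef, hc₁def]
  -- the profiles: `G = G̃` along the frame
  have hGeq : ∀ a b x, phaseComp (𝔚.fluctFam a b) Rt (𝒟.D i t) n x =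
      phaseComp (𝔚.fluctZ a b) Rt (𝒟.D i t) n x := by
    intro a b x
    unfold phaseComp
    exact (𝔚.fluctZ_eq_of_mem a b (hP.mem x)
      (isSymm_tildeR (fun p q => H.eulerReynolds.symm t ht x p q) i) _).symm
  -- each of the 27 integrals
  have hI : ∀ c a b, |∫ x, (rhoI P S 𝒟.cut.η i t x * (jac (𝒟.D i t) x).adjugate c a *
      (jac (𝒟.D i t) x).adjugate c b) * phaseComp (𝔚.fluctFam a b) Rt (𝒟.D i t) n x| ≤
      (phaseConst K * Λ ^ 2 * ((n : ℝ) * ℓ)⁻¹) ^ K * F * U := by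
    intro c a b
    simp only [hGeq a b]
    exact hP.levelBound K le_rfl (𝔚.fluctZ a b) _ F U (𝔚.jointSmooth_fluctZ a b) (𝔚.integral_fluctZ a b)
      (hfs c a b) hF (hfB c a b) hU0 (hU a b)
  -- integrability and splitting of the integral
  have hint : ∀ c a b, Integrable fun x => (rhoI P S 𝒟.cut.η i t x * (jac (𝒟.D i t) x).adjugate c a *
      (jac (𝒟.D i t) x).adjugate c b) * phaseComp (𝔚.fluctFam a b) Rt (𝒟.D i t) n x := fun c a b =>
    ((hfs c a b).mul ((𝔚.jointSmooth_fluctFam a b).phaseComp hP.smooth_Rt hP.smooth_D n)).integrable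
  have hsplit : oscTermI P S 𝔚 𝒟.cut.η 𝒟.D i t = ∑ c, ∑ a, ∑ b, ∫ x,
      (rhoI P S 𝒟.cut.η i t x * (jac (𝒟.D i t) x).adjugate c a * (jac (𝒟.D i t) x).adjugate c b) *
        phaseComp (𝔚.fluctFam a b) Rt (𝒟.D i t) n x := by
    unfold oscTermI
    simp only [oscSummand_eq]
    rw [integral_finsetSum _ fun c _ =>
      integrable_finsetSum _ fun a _ => integrable_finsetSum _ fun b _ => hint c a b]
    refine Finset.sum_congr rfl fun c _ => ?_
    rw [integral_finsetSum _ fun a _ => integrable_finsetSum _ fun b _ => hint c a b]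
    refine Finset.sum_congr rfl fun a _ => ?_
    rw [integral_finsetSum _ fun b _ => hint c a b]
  rw [hsplit]
  refine (Finset.abs_sum_le_sum_abs _ _).trans ?_
  have h27 : ∀ c, |∑ a, ∑ b, ∫ x, (rhoI P S 𝒟.cut.η i t x * (jac (𝒟.D i t) x).adjugate c a *
      (jac (𝒟.D i t) x).adjugate c b) * phaseComp (𝔚.fluctFam a b) Rt (𝒟.D i t) n x| ≤
      9 * ((phaseConst K * Λ ^ 2 * ((n : ℝ) * ℓ)⁻¹) ^ K * F * U) := by
    intro c
    refine (Finset.abs_sum_le_sum_abs _ _).trans ?_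
    have h9 : ∀ a, |∑ b, ∫ x, (rhoI P S 𝒟.cut.η i t x * (jac (𝒟.D i t) x).adjugate c a *
        (jac (𝒟.D i t) x).adjugate c b) * phaseComp (𝔚.fluctFam a b) Rt (𝒟.D i t) n x| ≤
        3 * ((phaseConst K * Λ ^ 2 * ((n : ℝ) * ℓ)⁻¹) ^ K * F * U) := by
      intro a
      refine (Finset.abs_sum_le_sum_abs _ _).trans ?_
      refine (Finset.sum_le_sum fun b _ => hI c a b).trans ?_
      simp
    refine (Finset.sum_le_sum fun a _ => h9 a).trans ?_
    simp only [Finset.sum_const, Finset.card_univ, Fintype.card_fin, nsmul_eq_mul, Nat.cast_ofNat]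
    linarith
  refine (Finset.sum_le_sum fun c _ => h27 c).trans ?_
  simp only [Finset.sum_const, Finset.card_univ, Fintype.card_fin, nsmul_eq_mul, Nat.cast_ofNat]
  rw [hFdef, hc₁def, hδdef, hΛdef, hndef, hℓdef]
  linarith

end TermI

section Discharge

variable {P : Params} {S : Setting} {Nbar : ℕ} {Cin C₀ c₀ : ℝ} {Cη : ℕ → ℕ → ℝ}

/-- The summands of the oscillatory integrand are integrable (smooth) under the standing
hypotheses with `ρ_q > 0`. [folklore] -/
theorem PerturbationData.integrable_oscSummand (H : CoreHypotheses P S Nbar Cin C₀)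
    (𝒟 : PerturbationData P S c₀ Cη) (𝔚 : MikadoDatum mikadoRadius) (hc₀ : 0 < c₀)
    (hρ : ∀ s ∈ Icc 0 S.T, 0 < rhoQ P S s) (i : ℕ) {t : ℝ} (ht : t ∈ Icc 0 S.T) :
    Integrable fun x => rhoI P S 𝒟.cut.η i t x * Matrix.trace ((gradPhi 𝒟.D i t x).adjugate *
      𝔚.fluct (tildeR P S 𝒟.cut.η 𝒟.D i t x) (P.freqNat (S.q + 1) • phiPoint 𝒟.D i t x) *
        ((gradPhi 𝒟.D i t x).adjugate)ᵀ) := by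
  have hSD : SmoothData P S 𝒟.cut.η 𝒟.D := H.toSmoothData hc₀ 𝒟 hρ
  have hρs : IsSmooth (rhoI P S 𝒟.cut.η i t) := (hSD.rhoI i).isSmooth_slice ht
  have hDs : IsSmooth (𝒟.D i t) := (𝒟.flow i).smooth.isSmooth_slice ht
  have hA : ∀ m j, IsSmooth fun x => (jac (𝒟.D i t) x).adjugate m j := fun m j =>
    isSmooth_adjugate_jac_entry hDs m j
  have hRt : IsSmooth fun x => tildeR P S 𝒟.cut.η 𝒟.D i t x :=
    𝒟.isSmooth_tildeR H (fun s hs => (hρ s hs).ne') i ht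
  have hterm : ∀ c a b, Integrable fun x => (rhoI P S 𝒟.cut.η i t x * (jac (𝒟.D i t) x).adjugate c a *
      (jac (𝒟.D i t) x).adjugate c b) * phaseComp (𝔚.fluctFam a b)
        (fun y => tildeR P S 𝒟.cut.η 𝒟.D i t y) (𝒟.D i t) (P.freqNat (S.q + 1)) x := fun c a b =>
    (((hρs.mul (hA c a)).mul (hA c b)).mul
      ((𝔚.jointSmooth_fluctFam a b).phaseComp hRt hDs _)).integrable
  have e : (fun x => rhoI P S 𝒟.cut.η i t x * Matrix.trace ((gradPhi 𝒟.D i t x).adjugate *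
      𝔚.fluct (tildeR P S 𝒟.cut.η 𝒟.D i t x) (P.freqNat (S.q + 1) • phiPoint 𝒟.D i t x) *
        ((gradPhi 𝒟.D i t x).adjugate)ᵀ)) = fun x => ∑ c, ∑ a, ∑ b,
      (rhoI P S 𝒟.cut.η i t x * (jac (𝒟.D i t) x).adjugate c a * (jac (𝒟.D i t) x).adjugate c b) *
        phaseComp (𝔚.fluctFam a b) (fun y => tildeR P S 𝒟.cut.η 𝒟.D i t y) (𝒟.D i t)
          (P.freqNat (S.q + 1)) x := funext fun x => oscSummand_eq 𝔚 𝒟.cut.η 𝒟.D i t x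
  rw [e]
  exact integrable_finsetSum _ fun c _ => integrable_finsetSum _ fun a _ =>
    integrable_finsetSum _ fun b _ => hterm c a b

/-- `Osc(t) = ∑_i (i-th summand)` (integral of a finite sum). [folklore] -/
theorem PerturbationData.oscTerm_eq_sum (H : CoreHypotheses P S Nbar Cin C₀)
    (𝒟 : PerturbationData P S c₀ Cη) (𝔚 : MikadoDatum mikadoRadius) (hc₀ : 0 < c₀)
    (hρ : ∀ s ∈ Icc 0 S.T, 0 < rhoQ P S s) {t : ℝ} (ht : t ∈ Icc 0 S.T) :
    oscTerm P S 𝔚 𝒟.cut.η 𝒟.D t =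
      ∑ i ∈ Finset.range (cutoffCount S.T (P.τ S.q)), oscTermI P S 𝔚 𝒟.cut.η 𝒟.D i t := by
  unfold oscTerm oscIntegrand oscTermI
  exact integral_finsetSum _ fun i _ => 𝒟.integrable_oscSummand H 𝔚 hc₀ hρ i ht

/-- **Discharge of G₃′ `BDSV.energy_oscillatoryTerm`** (BDSV, proof of Prop. 6.2, last
paragraph): along the common prefix, `|Osc(t)| ≤ C δ_{q+1} δ_q^{1/2} λ_q λ_{q+1}⁻¹` for every
`t ∈ [0,T]`. The printed argument (Fourier expansion of `W ⊗ W - R`, `‖e_{q,i}‖_N ≲ δ_{q+1}ℓ^{-N}`,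
"at most two `e_{q,i}` are nonvanishing", the stationary-phase estimate (C.1), the choice of `N`
with `δ_{q+1}ℓ^{-N}λ_{q+1}^{-N} ≤ δ_{q+1}δ_q^{1/2}λ_qλ_{q+1}^{-1}`) is carried out with the
Fourier expansion replaced by the exact telescoping decomposition of the mean-free tensor into
`ξ`-derivatives (`OnsagerBDSVTorusPrimitives.lean`) and (C.1) by the `K`-fold integration by
parts of `OnsagerBDSVNonstationaryPhase.lean` (`K = ⌈2(b-1+β)/((b-1)(1-β))⌉ + 1`,
`α < (b-1)(1-β)/3`); the inputs are the proved deformation bounds `BDSV.gradPhiBound_holds`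
(Prop. 5.7, all orders `≤ K`), (2.20), Lemma 5.4 (`BDSV.PerturbationData.tildeR_mem_closedBall`,
`ρ_q` bounds) and the parameter inequality `BDSV.exists_threshold_phase`.
[cite: BuckmasterEtAl2018, Prop. 6.2 (proof, last paragraph) and Prop. C.2 (C.1)] -/
theorem energy_oscillatoryTerm_holds : energy_oscillatoryTerm := by
  intro 𝔚 c₀ hc₀ Cη β hβ hβ' b hb hb'
  have hb0 : (0 : ℝ) < b := by linarith
  have hb1 : 0 < b - 1 := by linarith
  have h1β : 0 < 1 - β := by linarith
  have hβb : 0 < β * b * (b - 1) := by positivity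
  have hpos : 0 < (b - 1) * (1 - β) := mul_pos hb1 h1β
  obtain ⟨αJ, hαJ, hJall⟩ := gradPhiBound_allOrders c₀ hc₀ Cη β hβ hβ' b hb hb'
  refine ⟨min (min αJ (β * b * (b - 1))) ((b - 1) * (1 - β) / 3),
    lt_min (lt_min hαJ hβb) (by positivity), fun α hα hαlt => ?_⟩
  have hα₁ : α < αJ := lt_of_lt_of_le hαlt ((min_le_left _ _).trans (min_le_left _ _))
  have hα₂ : α < β * b * (b - 1) := lt_of_lt_of_le hαlt ((min_le_left _ _).trans (min_le_right _ _))
  have hα₃ : α < (b - 1) * (1 - β) / 3 := lt_of_lt_of_le hαlt (min_le_right _ _)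
  have hαb : α < 2 * β * b * (b - 1) := by nlinarith
  -- the number of integrations by parts
  set K : ℕ := ⌈2 * (b - 1 + β) / ((b - 1) * (1 - β))⌉₊ + 1 with hKdef
  have hKineq : b - 1 + β < K * ((b - 1) * (1 - β) - 3 * α / 2) := by
    have hD : (b - 1) * (1 - β) / 2 ≤ (b - 1) * (1 - β) - 3 * α / 2 := by nlinarith
    have hKge : 2 * (b - 1 + β) / ((b - 1) * (1 - β)) < K := by
      rw [hKdef]
      push_cast
      have := Nat.le_ceil (2 * (b - 1 + β) / ((b - 1) * (1 - β)))
      linarith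
    have h1 : 2 * (b - 1 + β) < K * ((b - 1) * (1 - β)) := (div_lt_iff₀ hpos).1 hKge
    have hK0 : (0 : ℝ) ≤ K := Nat.cast_nonneg _
    nlinarith [mul_le_mul_of_nonneg_left hD hK0]
  obtain ⟨NJ, hNJ⟩ := hJall α hα hα₁ K
  obtain ⟨U, hU0, hU⟩ := 𝔚.exists_bound_descSet_fluctZ K
  refine ⟨max NJ K, fun Cin C₀ => ?_⟩
  -- constants
  set Cin' : ℝ := max Cin 0 with hCin'def
  have hCp0 : 0 ≤ Cin' := le_max_right _ _
  obtain ⟨CJ, aJ, haJ, hCJall⟩ := hNJ Cin' C₀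
  set CJ' : ℝ := max CJ 0 with hCJ'def
  have hCJ'0 : 0 ≤ CJ' := le_max_right _ _
  set Λ : ℝ := frameConst K CJ' Cin' with hΛdef
  have hΛ1 : 1 ≤ Λ := (frameConst_bounds K hCJ'0 hCp0).1
  have hΛ0 : 0 ≤ Λ := zero_le_one.trans hΛ1
  set Cη' : ℝ := ∑ k ∈ Finset.range (K + 1), |Cη 0 k| with hCη'def
  set c₁ : ℝ := (3 : ℝ) ^ K * (K + 1) with hc₁def
  set F₁ : ℝ := c₁ * (c₁ * (1 / c₀ * (c₁ * Cη' ^ 2)) * Λ) * Λ with hF₁def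
  have hF₁ : 0 ≤ F₁ := by positivity
  set PK : ℝ := (phaseConst K * Λ ^ 2) ^ K with hPKdef
  have hPK : 0 ≤ PK := pow_nonneg (mul_nonneg (phaseConst_nonneg K) (sq_nonneg Λ)) K
  -- thresholds
  obtain ⟨a₁, ha₁, hpar₁⟩ := exists_threshold_four_amp hb hαb
  obtain ⟨a₂, ha₂, hpar₂⟩ := exists_threshold_deformation hβ.le hb.le hα hCp0 (b := b)
  obtain ⟨a₃, ha₃, hpar₃⟩ := exists_threshold_freq_mul_mollScale_rpow_le hβ.le hb.le hα (8 * Cin')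
    (by norm_num : (0 : ℝ) < 1 / 100)
  obtain ⟨a₄, ha₄, hpar₄⟩ := exists_threshold_phase hb.le hKineq (β := β) (α := α)
  refine ⟨54 * PK * (2 * Real.pi) ^ K * F₁ * U, max (max (max a₁ a₂) (max a₃ a₄)) aJ,
    lt_max_of_lt_left (lt_max_of_lt_left (lt_max_of_lt_left ha₁)), fun a ha S H 𝒟 t ht => ?_⟩
  have ha₁' : a₁ ≤ a := le_trans (le_max_left _ _) (le_trans (le_max_left _ _) (le_trans (le_max_left _ _) ha))
  have ha₂' : a₂ ≤ a := le_trans (le_max_right _ _) (le_trans (le_max_left _ _) (le_trans (le_max_left _ _) ha))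
  have ha₃' : a₃ ≤ a := le_trans (le_max_left _ _) (le_trans (le_max_right _ _) (le_trans (le_max_left _ _) ha))
  have ha₄' : a₄ ≤ a := le_trans (le_max_right _ _) (le_trans (le_max_right _ _) (le_trans (le_max_left _ _) ha))
  have haJ' : aJ ≤ a := le_trans (le_max_right _ _) ha
  have ha1 : (1 : ℝ) ≤ a := ha₁.le.trans ha₁'
  have ha0 : (0 : ℝ) ≤ a := zero_le_one.trans ha1
  -- the hypotheses with the nonnegative constant `Cin'`
  have H' : CoreHypotheses ⟨β, α, a, b⟩ S (max NJ K) Cin' C₀ := H.mono_const ha1 (le_max_left _ _)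
  have HJ : CoreHypotheses ⟨β, α, a, b⟩ S NJ Cin' C₀ := H'.of_le (le_max_left _ _)
  have h4 := hpar₁ a ha₁' S.q
  have hdef := hpar₂ a ha₂' S.q
  have hstr : 8 * (Cin' * (freq a b S.q ^ α * mollScale β α a b S.q ^ α)) ≤ 1 / 100 := by
    have := hpar₃ a ha₃' S.q
    linarith
  -- scales
  set ℓ : ℝ := mollScale β α a b S.q with hℓdef
  set n : ℕ := Params.freqNat ⟨β, α, a, b⟩ (S.q + 1) with hndef
  set δ : ℝ := amp β a b (S.q + 1) with hδdef
  have hℓ : 0 < ℓ := mollScale_pos ha1 _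
  have hδ : 0 < δ := amp_pos ha1 _
  have hf1 := freq_pos (b := b) ha1 (S.q + 1)
  have hnr : (0 : ℝ) < n := Nat.cast_pos.2 (Params.freqNat_pos ⟨β, α, a, b⟩ ha1 _)
  set X : ℝ := phaseConst K * Λ ^ 2 * ((n : ℝ) * ℓ)⁻¹ with hXdef
  have hX : 0 ≤ X := mul_nonneg (mul_nonneg (phaseConst_nonneg K) (sq_nonneg Λ))
    (inv_nonneg.2 (mul_nonneg hnr.le hℓ.le))
  set B : ℝ := 27 * (X ^ K * (c₁ * (c₁ * (δ / c₀ * (c₁ * Cη' ^ 2)) * Λ) * Λ) * U) with hBdef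
  have hB0 : 0 ≤ B := by positivity
  have hρpos : ∀ s ∈ Icc 0 S.T, 0 < rhoQ ⟨β, α, a, b⟩ S s := fun s hs =>
    lt_of_lt_of_le (div_pos (mul_pos (amp_pos ha1 _) (Real.rpow_pos_of_pos (freq_pos ha1 _) _))
      (by norm_num)) (H'.le_rhoQ h4 hs)
  -- every summand is bounded by `B`
  have hterm : ∀ i, |oscTermI ⟨β, α, a, b⟩ S 𝔚 𝒟.cut.η 𝒟.D i t| ≤ B := by
    intro i
    by_cases hact : ∃ x, 𝒟.cut.η i t x ≠ 0
    · obtain ⟨x', hx'⟩ := hact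
      have hti : t ∈ tildeInterval S.T (Params.τ ⟨β, α, a, b⟩ S.q) i := 𝒟.cut.mem_tildeInterval ht hx'
      have hJK := fun k hk => hCJall a haJ' S HJ 𝒟 i k hk
      have hℓk : ∀ k : ℕ, 0 ≤ ℓ ^ (-(k : ℝ)) := fun k => Real.rpow_nonneg hℓ.le _
      have hJ : ∀ k ≤ K, Torus.eContDiffHolderNorm k 0 (fun x => gradPhi 𝒟.D i t x) ≤
          ENNReal.ofReal (CJ' * ℓ ^ (-(k : ℝ))) := fun k hk =>
        ((hJK k hk).1.mono (mul_le_mul_of_nonneg_right (le_max_left _ _) (hℓk k))) t hti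
      have hJinv : ∀ k ≤ K, Torus.eContDiffHolderNorm k 0 (fun x => (gradPhi 𝒟.D i t x)⁻¹) ≤
          ENNReal.ofReal (CJ' * ℓ ^ (-(k : ℝ))) := fun k hk =>
        ((hJK k hk).2.mono (mul_le_mul_of_nonneg_right (le_max_left _ _) (hℓk k))) t hti
      exact 𝒟.abs_oscTermI_le H' 𝔚 hc₀ hCp0 ha1 hb.le hβ.le hα.le h4 hdef hstr (le_max_right _ _)
        hCJ'0 ht hJ hJinv hx' hU0 hU
    · simp only [not_exists, not_not] at hact
      rw [oscTermI_eq_zero_of_eta 𝔚 𝒟 hact, abs_zero]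
      exact hB0
  -- at most two summands are nonzero
  have hτ : 0 < Params.τ ⟨β, α, a, b⟩ S.q := glueScale_pos ha1 _
  have hsum : |oscTerm ⟨β, α, a, b⟩ S 𝔚 𝒟.cut.η 𝒟.D t| ≤ 2 * B := by
    rw [𝒟.oscTerm_eq_sum H' 𝔚 hc₀ hρpos ht]
    exact (Finset.abs_sum_le_sum_abs _ _).trans (𝒟.cut.sum_abs_le_two_mul hτ hB0
      (fun i h0 => oscTermI_eq_zero_of_eta 𝔚 𝒟 h0) hterm _)
  refine hsum.trans ?_
  -- the parameter step: `X^K ≤ (phaseConst Λ²)^K (2π)^K δ_q^{1/2} λ_q λ_{q+1}⁻¹`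
  set T₀ : ℝ := Real.sqrt (amp β a b S.q) * freq a b S.q * (freq a b (S.q + 1))⁻¹ with hT₀def
  have hT₀ : 0 ≤ T₀ :=
    mul_nonneg (mul_nonneg (Real.sqrt_nonneg _) (freq_pos ha1 _).le) (inv_nonneg.2 hf1.le)
  have hfreq : freq a b (S.q + 1) = 2 * Real.pi * (n : ℝ) := Params.freq_eq ⟨β, α, a, b⟩ ha0 (S.q + 1)
  have hnl : ((n : ℝ) * ℓ)⁻¹ = 2 * Real.pi * (ℓ * freq a b (S.q + 1))⁻¹ := by
    rw [hfreq]
    field_simp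
  have hnlK : (((n : ℝ) * ℓ)⁻¹) ^ K ≤ (2 * Real.pi) ^ K * T₀ := by
    rw [hnl, mul_pow]
    exact mul_le_mul_of_nonneg_left (hpar₄ a ha₄' S.q) (by positivity)
  have hXK : X ^ K ≤ PK * ((2 * Real.pi) ^ K * T₀) := by
    rw [hXdef, mul_pow, ← hPKdef]
    exact mul_le_mul_of_nonneg_left hnlK hPK
  have hF : c₁ * (c₁ * (δ / c₀ * (c₁ * Cη' ^ 2)) * Λ) * Λ = F₁ * δ := by
    rw [hF₁def]
    ring
  calc 2 * B = 54 * X ^ K * (F₁ * δ) * U := by rw [hBdef, hF]; ring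
    _ ≤ 54 * (PK * ((2 * Real.pi) ^ K * T₀)) * (F₁ * δ) * U := by
        gcongr
    _ = 54 * PK * (2 * Real.pi) ^ K * F₁ * U * (δ * T₀) := by ring
    _ = 54 * PK * (2 * Real.pi) ^ K * F₁ * U *
        (amp β a b (S.q + 1) * Real.sqrt (amp β a b S.q) * freq a b S.q * (freq a b (S.q + 1))⁻¹) := by
        rw [hδdef, hT₀def]
        ring

/-- **Discharge of G₃ `BDSV.energy_principalTerm`** (`|∫|w_o|² - 3ρ_q| ≲ δ_{q+1}δ_q^{1/2}λ_qλ_{q+1}⁻¹`,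
BDSV, proof of Prop. 6.2, last paragraph): the proved reduction
`BDSV.energy_principalTerm_of_oscillatoryTerm` applied to `BDSV.energy_oscillatoryTerm_holds`.
[cite: BuckmasterEtAl2018, Prop. 6.2 (proof, last paragraph)] -/
theorem energy_principalTerm_holds : energy_principalTerm :=
  energy_principalTerm_of_oscillatoryTerm energy_oscillatoryTerm_holds

end Discharge

end DeRosa

/-! ## Port of `OnsagerBDSVEnergyEstimateHolds` -/

namespace DeRosa

open BDSV

/-- **Prop. 6.2 of BDSV, discharged** (`|e(t) - ∫|v_{q+1}|² - δ_{q+2}/2| ≲ δ_q^{1/2}δ_{q+1}^{1/2}λ_q^{1+2α}λ_{q+1}⁻¹`,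
as transcribed by the named fact `BDSV.energyEstimate`): the proved assembly
`BDSV.energyEstimate_of_parts` (proof of Prop. 6.2) applied to the three proved estimates
`BDSV.energy_crossTerm_holds` (G₁), `BDSV.energy_correctorTerm_holds` (G₂),
`BDSV.energy_principalTerm_holds` (G₃). [cite: BuckmasterEtAl2018, Prop. 6.2] -/
theorem energyEstimate_holds : energyEstimate :=
  energyEstimate_of_parts energy_crossTerm_holds energy_correctorTerm_holds
    energy_principalTerm_holds

end DeRosa

/-! ## Part 5 of `DeRosa.perturbationStage_of_parts` -/

namespace DeRosa

open BDSV

/-- **Part 5: the energy estimate (De Rosa Prop. 5.12 = BDSV Prop. 6.2) under the core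
hypotheses**, in the shape consumed by `DeRosa.perturbationStage_of_parts` (`DeRosa.energyPart`).
[cite: Derosa2018, §5.5 Prop. 5.12] -/
theorem energy_part (𝔚 : MikadoDatum mikadoRadius) (c₀ : ℝ) (hc₀ : 0 < c₀) (Cη : ℕ → ℕ → ℝ) :
    energyPart 𝔚 c₀ Cη :=
  energyEstimate_holds 𝔚 c₀ hc₀ Cη

end DeRosa

end Literature.Analysis.FluidPDE
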